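import Literature.Analysis.FluidPDE.StokesTorusProofs
import Literature.Analysis.FluidPDE.StatisticalSolutionEnergyEq
import HarnessLib

/-!
# The Stokes operator on `T^d` is diagonal in any basis of Stokes modes (discharge)

Second sibling proof file of `Literature/Analysis/FluidPDE/StokesTorus.lean` (next to
`StokesTorusProofs.lean`, which discharges `Torus.galerkinSpace_le_energySpace`). It discharges the
named fact `Torus.stokesOperatorH_eq_diagonalPMap` (D-0014: `def X : Prop` discharged as
`theorem X_holds : X`): for every Hilbert basis `b` of the energy space `H = Torus.energySpace d`
consisting of Stokes modes `Torus.stokesModeL2 k a c` (`x ↦ cos(2πk·x) a`, `x ↦ sin(2πk·x) a`)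
with symbol `m i = 4π²|k|²`, the graph-defined Stokes operator in `H`, `Torus.stokesOperatorH d`,
*equals* the maximal diagonal operator `b.diagonalPMap m`, domains included.

This is the periodic-case description of the Stokes operator in Constantin–Foias, *Navier–Stokes
Equations* (1988), Ch. 4, (4.33)–(4.37): `H = {u | ū_k = u_{-k}, u_0 = 0, ⟨u_k, k⟩ = 0}`,
`𝒟(A) = H_{2,L} ∩ H`, `A u = ∑_k (4π²/L²)|k|² u_k w_k`, i.e. `(A u)_k = (4π²/L²)|k|² u_k`
(here `L = 1`), together with (4.7)–(4.9): the eigenfunctions `(w_j)` form an orthonormal basis of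
`H` and `𝒟(A) = {u = ∑ u_j w_j | ∑ λ_j² |u_j|² < ∞}`.

## Proof

Write `A = stokesOperatorH d` (graph: `(v, w)` with `⟪w, φ⟫ = -⟪v, ψ⟫` for every smooth
divergence-free mean-zero `g`, `φ = g`, `ψ = Δ g` a.e.) and `D = b.diagonalPMap m`.

* Each basis vector is, as a function, the single real trigonometric mode `realTrigPoly {k} z`,
  `z = (1 or -i) • complexify a` (`stokesMode_eq_realTrigPoly` of `StokesTorusProofs`), so it is
  smooth, `Δ (b i) = -m i (b i)`, and it satisfies the weak Stokes relation
  `⟪m i • b i, φ⟫ = -⟪b i, ψ⟫` against every smooth solenoidal mean-zero test field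
  (`isStokesImage_stokesModeL2` of `StokesTorusProofs`), i.e. `⟪b i, ψ⟫ = -m i ⟪b i, φ⟫`
  (`inner_basis_laplacian`).
* `D ≤ A`: for `v ∈ dom D` expand `⟪D v, P φ⟫` and `⟪v, P ψ⟫` in the basis
  (`HilbertBasis.hasSum_inner_mul_inner`, `P` the orthogonal projection onto `H`); the two series
  agree termwise by the previous bullet and `⟪b i, D v⟫ = m i ⟪b i, v⟫`.
* `dom A ≤ dom D`: for `v ∈ dom A` with `w = A v`, test the weak relation against the mode `b i`
  itself. It is an admissible test field: smooth; divergence free because `b i ∈ H` is weakly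
  divergence free (`Torus.isWeaklyDivFree_of_mem_energySpace`), whence its Fourier coefficient
  `z/2` at `k` is transversal (`IsWeaklyDivFree.sum_mul_mFourierCoeff_eq_zero`,
  `Torus.mFourierCoeff_realTrigPoly_singleton`, `Torus.isDivFree_realTrigPoly_singleton`); mean zero
  for `k ≠ 0` (`hasZeroMean_stokesMode`). This gives `⟪b i, w⟫ = m i ⟪b i, v⟫`; for `k = 0` the
  mode is constant, `m i = 0`, and `⟪b i, w⟫ = ⟪const, ∫ w⟫ = 0` since elements of `H` have zero
  mean (`Torus.integral_eq_zero_of_mem_energySpace`). Hence `(m i ⟪b i, v⟫)ᵢ` is the coordinate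
  sequence of `w`, square summable, i.e. `v ∈ dom D`.
* `LinearPMap.eq_of_le_of_domain_eq` concludes.

No new definitions and no new named facts are introduced (D-0026). The easy inclusion
`H ⊆ {weakly divergence free} ∩ {mean zero}` is imported from `StatisticalSolutionEnergyEq`
(`Torus.isWeaklyDivFree_of_mem_energySpace`, `Torus.integral_eq_zero_of_mem_energySpace`), as in
`LerayProjectorTorusProofs`.

## References

* P. Constantin, C. Foias, *Navier–Stokes Equations*, Chicago Lectures in Mathematics, Univ. of
  Chicago Press (1988), Ch. 4: Def. 4.1, (4.7)–(4.9), and the periodic case (4.28)–(4.42).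
-/

noncomputable section

open MeasureTheory TopologicalSpace Filter UnitAddTorus
open scoped InnerProductSpace RealInnerProductSpace ENNReal Topology

namespace Literature.Analysis.FluidPDE

namespace Torus

variable {d : Type*} [Fintype d] [DecidableEq d]

/-! ### Stokes modes lying in `H` have transversal amplitude -/

/-- The Fourier coefficient of a Stokes mode of frequency `k ≠ 0` at `k` is half its complexified
amplitude: `𝓕(Re (e_k • z))(k) = z / 2`. [folklore] -/
theorem mFourierCoeff_stokesMode_self {k : d → ℤ} (hk : k ≠ 0) (a : EuclideanSpace ℝ d)
    (c : Bool) :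
    mFourierCoeff (FunctionSpaces.EuclideanSpace.complexify ∘
        (stokesMode k a c : UnitAddTorus d → EuclideanSpace ℝ d)) k =
      (2 : ℂ)⁻¹ •
        ((if c then (1 : ℂ) else -Complex.I) • FunctionSpaces.EuclideanSpace.complexify a) := by
  rw [stokesMode_eq_realTrigPoly, FunctionSpaces.Torus.mFourierCoeff_realTrigPoly_singleton,
    if_pos rfl, if_neg (self_ne_neg.mpr hk), FunctionSpaces.EuclideanSpace.conjVec_zero,
    add_zero]

/-- **Stokes modes lying in `H` have transversal amplitude.** If the `L²` class of
`stokesMode k a c` (`k ≠ 0`) belongs to the energy space `H`, then `∑ⱼ kⱼ zⱼ = 0` for its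
complexified amplitude `z`: elements of `H` are weakly divergence free, so their Fourier
coefficients are transversal (Constantin–Foias 1988, Ch. 4, (4.33): `⟨u_k, k⟩ = 0` on `H`).
[folklore] -/
theorem sum_mul_amplitude_eq_zero_of_mem_energySpace {k : d → ℤ} (hk : k ≠ 0)
    {a : EuclideanSpace ℝ d} {c : Bool}
    (hmem : stokesModeL2 k a c ∈ FunctionSpaces.Torus.energySpace d) :
    ∑ j, (k j : ℂ) *
      ((if c then (1 : ℂ) else -Complex.I) • FunctionSpaces.EuclideanSpace.complexify a) j = 0 := by
  have hdiv := isWeaklyDivFree_of_mem_energySpace hmem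
  have hL2 : MemLp (stokesModeL2 k a c : UnitAddTorus d → EuclideanSpace ℝ d) 2 volume :=
    Lp.memLp _
  have h := hdiv.sum_mul_mFourierCoeff_eq_zero hL2 k
  have hcoe : mFourierCoeff (FunctionSpaces.EuclideanSpace.complexify ∘
        (stokesModeL2 k a c : UnitAddTorus d → EuclideanSpace ℝ d)) k =
      mFourierCoeff (FunctionSpaces.EuclideanSpace.complexify ∘
        (stokesMode k a c : UnitAddTorus d → EuclideanSpace ℝ d)) k :=
    FunctionSpaces.Torus.mFourierCoeff_congr_ae
      ((coeFn_stokesModeL2 k a c).fun_comp FunctionSpaces.EuclideanSpace.complexify) k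
  rw [hcoe, mFourierCoeff_stokesMode_self hk] at h
  simp only [PiLp.smul_apply, smul_eq_mul] at h ⊢
  have h2 : ∑ j, (k j : ℂ) *
        ((if c then (1 : ℂ) else -Complex.I) * FunctionSpaces.EuclideanSpace.complexify a j) =
      2 * ∑ j, (k j : ℂ) * ((2 : ℂ)⁻¹ *
        ((if c then (1 : ℂ) else -Complex.I) * FunctionSpaces.EuclideanSpace.complexify a j)) := by
    rw [Finset.mul_sum]
    refine Finset.sum_congr rfl fun j _ => ?_
    ring
  rw [h2, h, mul_zero]

/-! ### The discharge -/

section Diagonal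

variable {ι : Type*} (b : HilbertBasis ι ℝ (FunctionSpaces.Torus.energySpace d)) (m : ι → ℝ)
  (hb : ∀ i, ∃ (k : d → ℤ) (a : EuclideanSpace ℝ d) (c : Bool),
    ((b i : FunctionSpaces.Torus.energySpace d) :
      Lp (EuclideanSpace ℝ d) 2 (volume : Measure (UnitAddTorus d))) = stokesModeL2 k a c ∧
      m i = stokesEigenvalue k)

include hb

/-- Per-mode eigen-identity for a basis of Stokes modes: `⟪b i, ψ⟫ = -m i ⟪b i, φ⟫` whenever
`φ`, `ψ` are the `L²` classes of `g`, `Δ g` for a smooth solenoidal mean-zero test field `g`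
(the weak Stokes relation of a single mode, `isStokesImage_stokesModeL2`:
`𝓕(Δ g)(k) = -4π²|k|² ĝ(k)`; Constantin–Foias 1988, Ch. 4, (4.36)–(4.37)). [folklore] -/
theorem inner_basis_laplacian (i : ι)
    {φ ψ : Lp (EuclideanSpace ℝ d) 2 (volume : Measure (UnitAddTorus d))}
    {g : UnitAddTorus d → EuclideanSpace ℝ d}
    (hg : FunctionSpaces.Torus.IsSmooth g) (hdiv : FunctionSpaces.Torus.IsDivFree g)
    (hmean : FunctionSpaces.Torus.HasZeroMean g)
    (hφ : (φ : UnitAddTorus d → EuclideanSpace ℝ d) =ᵐ[volume] g)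
    (hψ : (ψ : UnitAddTorus d → EuclideanSpace ℝ d) =ᵐ[volume]
      fun x => FunctionSpaces.Torus.laplacian g x) :
    ⟪((b i : FunctionSpaces.Torus.energySpace d) :
        Lp (EuclideanSpace ℝ d) 2 (volume : Measure (UnitAddTorus d))), ψ⟫_ℝ =
      -m i * ⟪↑(b i), φ⟫_ℝ := by
  obtain ⟨k, a, c, hbi, hmi⟩ := hb i
  rw [hbi, hmi]
  have h := isStokesImage_stokesModeL2 k a c φ ψ g hg hdiv hmean hφ hψ
  rw [real_inner_smul_left] at h
  linarith

/-- **`D ≤ A`, pointwise**: every `v` in the maximal diagonal domain satisfies the weak Stokes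
relation with image `D v = ∑ m i ⟪b i, v⟫ b i` (expand both pairings in the basis after
projecting the test classes onto `H`; Constantin–Foias 1988, Ch. 4, (4.36)). [folklore] -/
theorem isStokesImage_diagonalPMap (x : (b.diagonalPMap m).domain) :
    IsStokesImage (d := d) (x : FunctionSpaces.Torus.energySpace d) (b.diagonalPMap m x) := by
  intro φ ψ g hg hdiv hmean hφ hψ
  set φ' := (FunctionSpaces.Torus.energySpace d).orthogonalProjectionOnto φ
  set ψ' := (FunctionSpaces.Torus.energySpace d).orthogonalProjectionOnto ψ
  have hPφ : ∀ u : FunctionSpaces.Torus.energySpace d, ⟪↑u, φ⟫_ℝ = ⟪u, φ'⟫_ℝ := fun u =>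
    (Submodule.inner_orthogonalProjectionOnto_eq_of_mem_left u φ).symm
  have hPψ : ∀ u : FunctionSpaces.Torus.energySpace d, ⟪↑u, ψ⟫_ℝ = ⟪u, ψ'⟫_ℝ := fun u =>
    (Submodule.inner_orthogonalProjectionOnto_eq_of_mem_left u ψ).symm
  -- coordinates of `D x` and the per-mode identity
  have h1 : ∀ i, ⟪(b.diagonalPMap m x : FunctionSpaces.Torus.energySpace d), b i⟫_ℝ =
      m i * ⟪(x : FunctionSpaces.Torus.energySpace d), b i⟫_ℝ := fun i => by
    have h := b.repr_diagonalPMap_apply m x i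
    rw [b.repr_apply_apply, b.repr_apply_apply] at h
    rw [real_inner_comm (b i), real_inner_comm (b i)]
    exact h
  have h2 : ∀ i, ⟪b i, ψ'⟫_ℝ = -m i * ⟪b i, φ'⟫_ℝ := fun i => by
    rw [← hPφ (b i), ← hPψ (b i)]
    exact inner_basis_laplacian b m hb i hg hdiv hmean hφ hψ
  rw [hPφ, hPψ]
  have hs1 := b.hasSum_inner_mul_inner (b.diagonalPMap m x : FunctionSpaces.Torus.energySpace d) φ'
  have hs2 := (b.hasSum_inner_mul_inner (x : FunctionSpaces.Torus.energySpace d) ψ').neg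
  have heq : (fun i => ⟪(b.diagonalPMap m x : FunctionSpaces.Torus.energySpace d), b i⟫_ℝ *
      ⟪b i, φ'⟫_ℝ) = fun i => -(⟪(x : FunctionSpaces.Torus.energySpace d), b i⟫_ℝ * ⟪b i, ψ'⟫_ℝ) :=
    funext fun i => by rw [h1 i, h2 i]; ring
  rw [heq] at hs1
  exact hs1.unique hs2

/-- **`D ≤ A`**: the maximal diagonal operator in a basis of Stokes modes is a restriction of the
graph-defined Stokes operator in `H` (Constantin–Foias 1988, Ch. 4, (4.35)–(4.36)). [folklore] -/
theorem diagonalPMap_le_stokesOperatorH : b.diagonalPMap m ≤ stokesOperatorH d := by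
  refine LinearPMap.le_of_le_graph ?_
  rw [graph_stokesOperatorH]
  intro p hp
  obtain ⟨x, hx1, hx2⟩ := (LinearPMap.mem_graph_iff _).mp hp
  change IsStokesImage (d := d) p.1 p.2
  rw [← hx1, ← hx2]
  exact isStokesImage_diagonalPMap b m hb x

/-- **Coordinates of `A v`**: for `v ∈ dom A`, `⟪b i, A v⟫ = m i ⟪b i, v⟫` — test the weak
Stokes relation against the mode `b i` itself (admissible: smooth, divergence free since `b i ∈ H`
has transversal amplitude, mean zero for `k ≠ 0`); for `k = 0` the mode is constant, `m i = 0`,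
and `⟪b i, A v⟫ = ⟪const, ∫ A v⟫ = 0` (Constantin–Foias 1988, Ch. 4, (4.37):
`(A u)_k = 4π²|k|² u_k`). [folklore] -/
theorem repr_stokesOperatorH_apply (x : (stokesOperatorH d).domain) (i : ι) :
    b.repr (stokesOperatorH d x) i = m i * b.repr (x : FunctionSpaces.Torus.energySpace d) i := by
  have hgraph :
      IsStokesImage (d := d) (x : FunctionSpaces.Torus.energySpace d) (stokesOperatorH d x) := by
    have h := (stokesOperatorH d).mem_graph x
    rw [graph_stokesOperatorH] at h
    exact h
  obtain ⟨k, a, c, hbi, hmi⟩ := hb i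
  rw [b.repr_apply_apply, b.repr_apply_apply, hmi, Submodule.coe_inner, Submodule.coe_inner, hbi]
  by_cases hk : k = 0
  · -- the constant mode: `m i = 0` and `A x` has zero mean
    subst hk
    have hev : stokesEigenvalue (0 : d → ℤ) = 0 := by
      simp [stokesEigenvalue, FunctionSpaces.Torus.freqNormSq]
    rw [hev, zero_mul, MeasureTheory.L2.inner_def]
    have hmode : ∀ y, stokesMode (0 : d → ℤ) a c y = (if c then (1 : ℝ) else 0) • a := fun y => by
      rw [stokesMode_apply, mFourier_zero]
      cases c <;> simp
    have hint : Integrable (fun y => ((stokesOperatorH d x : FunctionSpaces.Torus.energySpace d) :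
        Lp (EuclideanSpace ℝ d) 2 (volume : Measure (UnitAddTorus d))) y) volume :=
      (Lp.memLp _).integrable one_le_two
    calc ∫ y, ⟪(stokesModeL2 (0 : d → ℤ) a c : UnitAddTorus d → EuclideanSpace ℝ d) y,
          ((stokesOperatorH d x : FunctionSpaces.Torus.energySpace d) :
            Lp (EuclideanSpace ℝ d) 2 (volume : Measure (UnitAddTorus d))) y⟫_ℝ
        = ∫ y, ⟪(if c then (1 : ℝ) else 0) • a,
          ((stokesOperatorH d x : FunctionSpaces.Torus.energySpace d) :
            Lp (EuclideanSpace ℝ d) 2 (volume : Measure (UnitAddTorus d))) y⟫_ℝ :=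
          integral_congr_ae (by
            filter_upwards [coeFn_stokesModeL2 (0 : d → ℤ) a c] with y hy
            rw [hy, hmode])
      _ = ⟪(if c then (1 : ℝ) else 0) • a,
          ∫ y, ((stokesOperatorH d x : FunctionSpaces.Torus.energySpace d) :
            Lp (EuclideanSpace ℝ d) 2 (volume : Measure (UnitAddTorus d))) y⟫_ℝ :=
          integral_inner hint _
      _ = 0 := by
          rw [integral_eq_zero_of_mem_energySpace (stokesOperatorH d x).2, inner_zero_right]
  · -- test against the mode itself
    have hmemH : stokesModeL2 k a c ∈ FunctionSpaces.Torus.energySpace d := hbi ▸ (b i).2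
    have hz := sum_mul_amplitude_eq_zero_of_mem_energySpace hk hmemH
    have hae : (((-stokesEigenvalue k) • stokesModeL2 k a c :
        Lp (EuclideanSpace ℝ d) 2 (volume : Measure (UnitAddTorus d))) :
          UnitAddTorus d → EuclideanSpace ℝ d) =ᵐ[volume]
        fun y => FunctionSpaces.Torus.laplacian
          (stokesMode k a c : UnitAddTorus d → EuclideanSpace ℝ d) y := by
      filter_upwards [Lp.coeFn_smul (-stokesEigenvalue k) (stokesModeL2 k a c),
        coeFn_stokesModeL2 k a c] with y hy hy'
      rw [hy, Pi.smul_apply, hy', laplacian_stokesMode]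
    have hdiv : FunctionSpaces.Torus.IsDivFree ⇑(stokesMode k a c) := by
      rw [stokesMode_eq_realTrigPoly]
      exact FunctionSpaces.Torus.isDivFree_realTrigPoly_singleton hz
    have h := hgraph (stokesModeL2 k a c) ((-stokesEigenvalue k) • stokesModeL2 k a c)
      (stokesMode k a c) (isSmooth_stokesMode k a c) hdiv (hasZeroMean_stokesMode hk a c)
      (coeFn_stokesModeL2 k a c) hae
    rw [real_inner_smul_right] at h
    have hc1 : ⟪stokesModeL2 k a c, ((stokesOperatorH d x : FunctionSpaces.Torus.energySpace d) :
        Lp (EuclideanSpace ℝ d) 2 (volume : Measure (UnitAddTorus d)))⟫_ℝ =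
        ⟪↑(stokesOperatorH d x), stokesModeL2 k a c⟫_ℝ := real_inner_comm _ _
    have hc2 : ⟪stokesModeL2 k a c, ((x : FunctionSpaces.Torus.energySpace d) :
        Lp (EuclideanSpace ℝ d) 2 (volume : Measure (UnitAddTorus d)))⟫_ℝ =
        ⟪↑↑x, stokesModeL2 k a c⟫_ℝ :=
      real_inner_comm _ _
    rw [hc1, hc2, h]
    ring

/-- **`dom A ≤ dom D`**: on the domain of the Stokes operator the sequence `(m i ⟪b i, v⟫)ᵢ` is
the coordinate sequence of `A v`, hence square summable (Constantin–Foias 1988, Ch. 4, (4.9) with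
`α = 1`, (4.35)). [folklore] -/
theorem domain_stokesOperatorH_le_diagonalDomain :
    (stokesOperatorH d).domain ≤ b.diagonalDomain m := by
  intro v hv
  rw [HilbertBasis.mem_diagonalDomain_iff]
  have hfun : (fun i => m i * b.repr v i) = ⇑(b.repr (stokesOperatorH d ⟨v, hv⟩)) :=
    funext fun i => (repr_stokesOperatorH_apply b m hb ⟨v, hv⟩ i).symm
  rw [hfun]
  exact lp.memℓp _

end Diagonal

/-- Discharge of the named fact `Torus.stokesOperatorH_eq_diagonalPMap`: for any Hilbert basis `b`
of `H = Torus.energySpace d` consisting of Stokes modes `stokesModeL2 k a c` with symbol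
`m i = 4π²|k|²`, the graph-defined Stokes operator in `H` equals the maximal diagonal operator
`b.diagonalPMap m`, domains included. This is the periodic-case description of the Stokes operator
in Constantin–Foias, *Navier–Stokes Equations* (1988), Ch. 4: `𝒟(A) = H_{2,L} ∩ H` (4.35),
`A u = ∑_k (4π²/L²)|k|² u_k w_k` (4.36), `(A u)_k = (4π²/L²)|k|² u_k` (4.37) (here `L = 1`), with
(4.7)–(4.9): `(w_j)` is an orthonormal basis of `H` and `𝒟(A) = {∑ u_j w_j | ∑ λ_j² u_j² < ∞}`.
Proof: `D ≤ A` (`diagonalPMap_le_stokesOperatorH`) and `dom A ≤ dom D`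
(`domain_stokesOperatorH_le_diagonalDomain`), then `LinearPMap.eq_of_le_of_domain_eq`.
[cite: ConstantinFoias1988, Ch. 4 (4.35)–(4.37)] -/
theorem stokesOperatorH_eq_diagonalPMap_holds : stokesOperatorH_eq_diagonalPMap (d := d) := by
  intro ι b m hb
  have hle := diagonalPMap_le_stokesOperatorH b m hb
  have hdom : (b.diagonalPMap m).domain = (stokesOperatorH d).domain :=
    le_antisymm hle.1 (domain_stokesOperatorH_le_diagonalDomain b m hb)
  exact (LinearPMap.eq_of_le_of_domain_eq hle hdom).symm

end Torus

end Literature.Analysis.FluidPDE
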